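import Literature.MathematicalPhysics.QuantumFieldTheory.Balaban1983to89.B15Prop1GaugeRetractionOfGaugeSection

/-!
# `Balaban1983to89.B15Prop1AxialGaugeSectionOfForest` — [Balaban1985RegularSpaces] = «[6]», (1.19) p. 79 (the axial gauge `Ax_k(𝔅_k, U₀)`); [Balaban1985Variational] = «[15]»,
# (4) p. 278, (16)–(18) p. 280; [Balaban1985Averaging] (8) p. 18 («U^u(x, x′) = u(x) U(x, x′) u⁻¹(x′)»), (21) p. 21; [Balaban1988Convergent] = «[III]», (2.10)–(2.12) p. 256:
# THE RESIDUAL GAUGE-FIXING MAP `σ` OF A ROOTED FOREST — the four displayed letters (σ1)–(σ4) of `B15Prop1GaugeRetractionOfGaugeSection.gaugeRetraction_of_gaugeSection`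
# DISCHARGED for the axial slice of a rooted forest by the PATH-HOLONOMY GAUGE `σ_U(x) := 𝒰_{U₀}(path x)⁻¹ · 𝒰_U(path x)`; after this file the N12 criticality transfer
# displays only the CHOICE of print's comb `Ax_k(𝔅_k, U₀)` as a `path` datum (one application against the `treeWord`∕`iterBlockOf` objects of dag-n12-w3)

Honest framing: statement-level skeleton of published theorems with citation tags; proofs where landed; nothing here is a claim about the
Yang–Mills mass gap.  Cell `pub-ymgap`, HUMAN RULING D-0149 ∕ director-ym R399 (3a) (width seats), seat `pub-ymgap-dag-n12-w6` (g0; N12 = [B15]); lane word dag-n12-c g17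
«n12-w6 take σ» (cell bus 2026-08-28); `--kind proof --supports stmt-QuantumFields-20542`; count-neutral; N12 NOT discharged; finite 𝕋⁴ at fixed ε; nothing continuum ∕ ℝ⁴ ∕ OS ∕
mass-gap ∕ Clay.

WHY.  `B15Prop1GaugeRetractionOfGaugeSection.gaugeRetraction_of_gaugeSection` reduces the gauge-retraction letter `hπ` of the N12 criticality transfer
(`B15Prop1CritTransferOfGaugeRetraction`) to a residual gauge-fixing MAP `σ : U ↦ u(U)` with four clauses: (σ1) trivial on the slice chart, (σ2) moves every configuration into the
slice chart in logarithmic coordinates relative to `U₀`, (σ3) differentiable along differentiable curves, (σ4) RESIDUAL at the block towers of the constrained bonds ([15] (4)).  Print's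
instance is the axial gauge `Ax_k(𝔅_k, U₀)` of [6] (1.19), fixed by the explicit recursion `u(x′) = U₀(b)⁻¹u(x)U(b)` along tree bonds `b = ⟨x, x′⟩` from roots where `u = 1`; its
SOLUTION along the root-to-`x` path is the PATH-HOLONOMY GAUGE `u(x) = 𝒰_{U₀}(path x)⁻¹ · 𝒰_U(path x)` (ordered products of `U(b)^{±1}`, the tree's `T4Continuum.holAt`).  THIS FILE
proves (σ1)–(σ4) for that `u`, for an ABSTRACT rooted forest given by its paths `path : Site P 0 → List (LStep P 0)` with three honest letters: (F1) PREFIX∕ORIENTATION — every step on a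
path is the last step of a path whose prefix is a path, with the step's bond joining the two endpoints in the stated orientation (needed for (σ2) only); (F2) ROOTS — the block-tower sites
`embIter j y` of the endpoints of the bonds of `𝐁` (levels `≤ k`) have empty paths ([15] (4) «u(y) = 1 for y ∈ 𝔅_k»; needed for (σ4) only); (F3) SLICE — `S` is the axial slice of the
forest: `X ∈ S ↔ X` vanishes on every path bond ([6] (1.19)).  The choice of the 𝐁-adapted hierarchical comb of [6] (1.19) ∕ [III] (2.13) as such a `path` datum (dag-n12-w3's
`treeWord`∕`iterBlockOf` neighbourhood) is the ONE junction left displayed — no analysis.  PRECEDENT IN THE TREE (cited, not restated): the relative axial gauge `u := Ĉ⁻¹Â`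
(axial gauge function of the configuration times the inverse of that of the centre) of `B15Prop1RelativeAxialGauge` (lit-balaban-type-B15; the (1.77)-level, `x₁`-comb on a box,
with group-level smallness `exists_mem_orbit_relSmall`) is the same device at the level of the [IV] (1.77) variables; here it is run at the configuration level along an arbitrary
rooted forest, as a MAP with the four functional clauses (σ1)–(σ4) (no smallness estimate is needed or claimed).

CONTENTS (theorems only; no `def`, no `instance`, no `sorry`).  §1 holonomy plumbing (`holAt_append_single`, `holAt_congr_of_forall_mem`, `coe_inv_SU2_eq_star`, ★ the GAUGE
CONDITION `gaugeAct_pathGauge_apply_of_last` — `(U^{u})(b) = U₀(b)` at every last path step, both orientations, by telescoping in the group —, `pathGauge_eq_one_of_forall_mem`,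
`contDiff_pathGaugeAct` (the gauge-fixed field is a `C^∞` function of the bond matrices: finite products and adjoints, NODE 00's `contDiff_holM`)).  §2 ★★★
`exists_gaugeSection_of_forest` — (F1)(F2)(F3) ⟹ `∃ σ, (σ1) ∧ (σ2) ∧ (σ3) ∧ (σ4)` in the binder shapes of `gaugeRetraction_of_gaugeSection`, witnessed by the path-holonomy gauge.
§3 ★★ `gaugeRetraction_of_forest` (the letter `hπ` of p608195 from the forest datum alone), ★★ `hcritT_curve_of_forest` ∕ `hcritT_isCritOnFibre_of_forest` (w1's `hcritT` binder at
curve-criticality ∕ n07-e's `Node00.IsCritOnFibre` at the record, from the base-field data + (F1)–(F3)).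

NON-VACUITY.  The empty forest `path := fun _ => []` satisfies (F1) (vacuously), (F2), and (F3) with `S = ⊤` — the degenerate witness of `B15Prop1GaugeRetractionOfGaugeSection.gaugeRetraction_top`
again; the honest instance is the 𝐁-adapted comb (every non-representative fine site reached from the representative of its block tower by the comb word), where (F3) is print's `Ax_k`.

HONEST FRAMING: kernel group algebra (telescoping holonomies), smoothness of finite matrix products, `log 1 = 0`; nothing of Bałaban's asserted; (E), `hT1u` and the comb choice stay
displayed in the lane; N12 NOT discharged; K1⁷ NOT closed; counts unmoved; one finite 𝕋⁴ programme at fixed ε — NOT continuum ∕ ℝ⁴ ∕ OS ∕ mass gap ∕ Clay.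
-/

noncomputable section

namespace Literature.MathematicalPhysics.QuantumFieldTheory.Balaban1983to89.B15Prop1AxialGaugeSectionOfForest

open Set Metric Filter
open scoped Topology
open Literature.MathematicalPhysics.QuantumFieldTheory.Balaban1983to89.Node00 (SU coeField coeField_apply SmallBelow ConstrSet constrCard constrEnum IsCritOnFibre
  avOfRecord star_coe_mul_coe_SU coe_mul_star_coe_SU holM holM_nil holM_cons stepM coe_holAt contDiff_holM contDiff_eval)
open B15AveragingHolomorphic (iterMh)
open B15SU2ChartHolomorphic (genE expPointC expMulC logCoordC)
open B15Prop1DatumCoordinates (expPointC_zero logCoordC_one)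
open B15Prop1CritTransferOfGaugeRetraction (hcritT_curve_of_gaugeRetraction hcritT_isCritOnFibre_of_gaugeRetraction)
open B15Prop1GaugeRetractionOfGaugeSection (gaugeRetraction_of_gaugeSection)
open B16Sect1Backgrounds (toMS)
open ExpMeanLog (expMeanLogSU)
open BlockAveraging (blockAvg)
open T4CubeChartGnomonic (SU2)
open T4Continuum B15DeterminingSets
open GaugeField hiding holAt
open scoped Matrix.Norms.L2Operator

variable {P : Params}

/-! ## §1  Holonomy plumbing and the gauge condition of the path-holonomy gauge -/

section Plumbing

/-- Appending one step multiplies the holonomy on the right by the step variable. [cite: Balaban1985Averaging, (8) p.18 (bookkeeping)] -/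
theorem holAt_append_single (U : GaugeField P 0 SU2) (p : List (LStep P 0)) (s : LStep P 0) :
    holAt U (p ++ [s]) = holAt U p * (if s.fwd then U s.bond else (U s.bond)⁻¹) := by
  simp only [holAt, List.map_append, List.map_cons, List.map_nil, List.prod_append, List.prod_cons, List.prod_nil, mul_one]

/-- Two configurations that agree on the bonds of a walk have the same holonomy along it. [cite: Balaban1985Averaging, (8) p.18 (bookkeeping)] -/
theorem holAt_congr_of_forall_mem {U U' : GaugeField P 0 SU2} :
    ∀ {p : List (LStep P 0)}, (∀ s ∈ p, U s.bond = U' s.bond) → holAt U p = holAt U' p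
  | [], _ => by rw [holAt_nil, holAt_nil]
  | s :: p, h => by
    rw [holAt_cons, holAt_cons, h s (List.mem_cons_self ..), holAt_congr_of_forall_mem fun t ht => h t (List.mem_cons_of_mem s ht)]

/-- In `SU(2)` the matrix of the inverse is the adjoint (definitional). [cite: Balaban1985Variational, (4) p.278 (the group; bookkeeping)] -/
theorem coe_inv_SU2_eq_star (g : SU2) : (((g⁻¹ : SU2)) : Matrix (Fin 2) (Fin 2) ℂ) = star ((g : SU2) : Matrix (Fin 2) (Fin 2) ℂ) := rfl

/-- The matrix of a gauge-transformed bond variable. [cite: Balaban1985Averaging, (8) p.18] -/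
theorem coe_gaugeAct_apply (u : GaugeTransf P 0 SU2) (U : GaugeField P 0 SU2) (b : PBond P 0) :
    ((gaugeAct u U b : SU2) : Matrix (Fin 2) (Fin 2) ℂ) =
      ((u b.src : SU2) : Matrix (Fin 2) (Fin 2) ℂ) * ((U b : SU2) : Matrix (Fin 2) (Fin 2) ℂ) * star ((u b.tgt : SU2) : Matrix (Fin 2) (Fin 2) ℂ) := by
  simp only [GaugeField.gaugeAct, Submonoid.coe_mul, coe_inv_SU2_eq_star]

/-- ★ **THE GAUGE CONDITION OF THE PATH-HOLONOMY GAUGE** `u(x) := 𝒰_{U₀}(path x)⁻¹·𝒰_U(path x)`: if `path x″ = path x′ ++ [s]` with `s` joining `x′` to `x″` (forward: `s.bond = ⟨x′ → x″⟩`;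
backward: `s.bond = ⟨x″ → x′⟩`), then `(U^u)(s.bond) = U₀(s.bond)` — print's recursion `u(x″) = U₀(b)⁻¹u(x′)U(b)` telescoped ([6] (1.19) `Ax_k(𝔅_k, U₀)`: `U^u = U₀` on the tree bonds).
[cite: Balaban1985RegularSpaces, (1.19) p.79; Balaban1985Variational, (16)–(18) p.280; Balaban1985Averaging, (8) p.18] -/
theorem gaugeAct_pathGauge_apply_of_last (path : Site P 0 → List (LStep P 0)) (U₀ U : GaugeField P 0 SU2) {x' x'' : Site P 0} {s : LStep P 0}
    (hp : path x'' = path x' ++ [s]) (hfwd : s.fwd = true → s.bond.src = x' ∧ s.bond.tgt = x'') (hbwd : s.fwd = false → s.bond.src = x'' ∧ s.bond.tgt = x') :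
    gaugeAct (fun x => (holAt U₀ (path x))⁻¹ * holAt U (path x)) U s.bond = U₀ s.bond := by
  cases hs : s.fwd
  · obtain ⟨hsrc, htgt⟩ := hbwd hs
    show (holAt U₀ (path s.bond.src))⁻¹ * holAt U (path s.bond.src) * U s.bond * ((holAt U₀ (path s.bond.tgt))⁻¹ * holAt U (path s.bond.tgt))⁻¹ = U₀ s.bond
    rw [hsrc, htgt, hp, holAt_append_single, holAt_append_single, hs]
    simp only [Bool.false_eq_true, ↓reduceIte]
    group
  · obtain ⟨hsrc, htgt⟩ := hfwd hs
    show (holAt U₀ (path s.bond.src))⁻¹ * holAt U (path s.bond.src) * U s.bond * ((holAt U₀ (path s.bond.tgt))⁻¹ * holAt U (path s.bond.tgt))⁻¹ = U₀ s.bond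
    rw [hsrc, htgt, hp, holAt_append_single, holAt_append_single, hs]
    simp only [↓reduceIte]
    group

/-- **(σ1) FOR THE PATH-HOLONOMY GAUGE**: a configuration that agrees with `U₀` on every path bond is already gauge-fixed (`u ≡ 1`). [cite: Balaban1985RegularSpaces, (1.19) p.79] -/
theorem pathGauge_eq_one_of_forall_mem (path : Site P 0 → List (LStep P 0)) {U₀ U' : GaugeField P 0 SU2}
    (h : ∀ x, ∀ s ∈ path x, U' s.bond = U₀ s.bond) :
    (fun x => (holAt U₀ (path x))⁻¹ * holAt U' (path x)) = fun _ => 1 := by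
  funext x
  rw [holAt_congr_of_forall_mem (h x), inv_mul_cancel]

/-- **(σ3), FIELD LEVEL**: the gauge-fixed field `U ↦ ↑(U^{u(U)})` of the path-holonomy gauge is a `C^∞` function of the bond matrices (finite walk products and adjoints — NODE 00's
`contDiff_holM`), written through the matrix map `V ↦ (b ↦ (𝒰₀(p_{b₋})⋆·holM V p_{b₋}) · V b · (𝒰₀(p_{b₊})⋆·holM V p_{b₊})⋆)`. [cite: Balaban1987RG1, (0.4) p.253 («analytic function»; bookkeeping); Balaban1985Averaging, (8) p.18] -/
theorem contDiff_pathGaugeAct (path : Site P 0 → List (LStep P 0)) (U₀ : GaugeField P 0 SU2) :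
    ContDiff ℝ ⊤ fun (V : PBond P 0 → Matrix (Fin 2) (Fin 2) ℂ) (b : PBond P 0) =>
      star (holM (coeField U₀) (path b.src)) * holM V (path b.src) * V b *
        star (star (holM (coeField U₀) (path b.tgt)) * holM V (path b.tgt)) := by
  refine contDiff_pi.2 fun b => ?_
  have h1 : ContDiff ℝ ⊤ fun V : PBond P 0 → Matrix (Fin 2) (Fin 2) ℂ => star (holM (coeField U₀) (path b.src)) * holM V (path b.src) :=
    contDiff_const.mul (contDiff_holM _)
  have h2 : ContDiff ℝ ⊤ fun V : PBond P 0 → Matrix (Fin 2) (Fin 2) ℂ => star (star (holM (coeField U₀) (path b.tgt)) * holM V (path b.tgt)) :=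
    (starL' ℝ : Matrix (Fin 2) (Fin 2) ℂ ≃L[ℝ] Matrix (Fin 2) (Fin 2) ℂ).contDiff.comp (contDiff_const.mul (contDiff_holM _))
  exact (h1.mul (contDiff_eval b)).mul h2

/-- The matrix field of `U^{u(U)}` for the path-holonomy gauge is the matrix map of `contDiff_pathGaugeAct` at `↑U`. [cite: Balaban1985Averaging, (8) p.18 (bookkeeping)] -/
theorem coe_gaugeAct_pathGauge (path : Site P 0 → List (LStep P 0)) (U₀ U : GaugeField P 0 SU2) (b : PBond P 0) :
    ((gaugeAct (fun x => (holAt U₀ (path x))⁻¹ * holAt U (path x)) U b : SU2) : Matrix (Fin 2) (Fin 2) ℂ) =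
      star (holM (coeField U₀) (path b.src)) * holM (coeField U) (path b.src) * coeField U b *
        star (star (holM (coeField U₀) (path b.tgt)) * holM (coeField U) (path b.tgt)) := by
  rw [coe_gaugeAct_apply]
  simp only [Submonoid.coe_mul, coe_inv_SU2_eq_star, coe_holAt, coeField_apply]

end Plumbing

/-! ## §2  The four letters (σ1)–(σ4) for the path-holonomy gauge of a rooted forest -/

section Forest

/-- ★★★ **THE RESIDUAL GAUGE-FIXING MAP OF A ROOTED FOREST.**  For a base configuration `U₀`, a determining set `𝐁` read at levels `≤ k`, a slice `S`, and a rooted forest on `T_η` given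
by its root-to-site paths `path` with (F1) PREFIX∕ORIENTATION, (F2) ROOTS at the block-tower sites of the constrained bonds, (F3) `S` = the axial slice of the forest: the path-holonomy
gauge `σ_U(x) := 𝒰_{U₀}(path x)⁻¹·𝒰_U(path x)` satisfies the four displayed clauses (σ1)–(σ4) of `B15Prop1GaugeRetractionOfGaugeSection.gaugeRetraction_of_gaugeSection` — (σ1) from
(F3) (a slice-chart point agrees with `U₀` on the tree), (σ2) from the gauge condition `U^{σ U} = U₀` on the tree (§1, via (F1)) and `log 1 = 0`, (σ3) by smoothness of walk products,
(σ4) from (F2) (`𝒰(∅) = 1`). [cite: Balaban1985RegularSpaces, (1.19) p.79; Balaban1985Variational, (4) p.278, (16)–(18) p.280; Balaban1985Averaging, (8) p.18, (21) p.21; Balaban1988Convergent, (2.10)–(2.12) p.256] -/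
theorem exists_gaugeSection_of_forest (𝔹 : DetSet P) (k : ℕ) (U₀ : GaugeField P 0 SU2) (S : Submodule ℂ (VecField P 0 (EuclideanSpace ℂ (Fin 3))))
    -- DISPLAYED: the rooted forest by its root-to-site paths, with prefix∕orientation structure, roots and axial slice
    (path : Site P 0 → List (LStep P 0))
    (hF1 : ∀ x, ∀ s ∈ path x, ∃ x' x'' : Site P 0, path x'' = path x' ++ [s] ∧
      (s.fwd = true → s.bond.src = x' ∧ s.bond.tgt = x'') ∧ (s.fwd = false → s.bond.src = x'' ∧ s.bond.tgt = x'))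
    (hF2 : ∀ j, j ≤ k → ∀ c ∈ bondsOf (𝔹 j), path (embIter j c.src) = [] ∧ path (embIter j c.tgt) = [])
    (hF3 : ∀ X : VecField P 0 (EuclideanSpace ℂ (Fin 3)), X ∈ S ↔ ∀ x, ∀ s ∈ path x, X s.bond = 0) :
    ∃ σ : GaugeField P 0 SU2 → GaugeTransf P 0 SU2,
      (∀ (U' : GaugeField P 0 SU2) (X : VecField P 0 (EuclideanSpace ℂ (Fin 3))), X ∈ S → expMulC X (coeField U₀) = coeField U' → σ U' = fun _ => 1) ∧
      (∀ U : GaugeField P 0 SU2,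
        (fun b => logCoordC (((gaugeAct (σ U) U b : SU2) : Matrix (Fin 2) (Fin 2) ℂ) * star ((U₀ b : SU2) : Matrix (Fin 2) (Fin 2) ℂ))) ∈ S) ∧
      (∀ γ : ℝ → GaugeField P 0 SU2, DifferentiableAt ℝ (fun (t : ℝ) (b : PBond P 0) => ((γ t b : SU2) : Matrix (Fin 2) (Fin 2) ℂ)) 0 →
        DifferentiableAt ℝ (fun (t : ℝ) (b : PBond P 0) => ((gaugeAct (σ (γ t)) (γ t) b : SU2) : Matrix (Fin 2) (Fin 2) ℂ)) 0) ∧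
      (∀ (U : GaugeField P 0 SU2) j, j ≤ k → ∀ b ∈ bondsOf (𝔹 j), toMS (σ U) j b.src = 1 ∧ toMS (σ U) j b.tgt = 1) := by
  refine ⟨fun U x => (holAt U₀ (path x))⁻¹ * holAt U (path x), ?_, ?_, ?_, ?_⟩
  · -- (σ1): a slice-chart point agrees with `U₀` on every path bond
    intro U' X hX hXU'
    refine pathGauge_eq_one_of_forall_mem path fun x s hs => ?_
    have hX0 : X s.bond = 0 := (hF3 X).1 hX x s hs
    apply Subtype.ext
    have hb := congrFun hXU' s.bond
    simp only [expMulC, coeField_apply, hX0, expPointC_zero, one_mul] at hb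
    exact hb.symm
  · -- (σ2): the gauge condition on the tree and `log 1 = 0`
    intro U
    refine (hF3 _).2 fun x s hs => ?_
    obtain ⟨x', x'', hp, hfwd, hbwd⟩ := hF1 x s hs
    show logCoordC (((gaugeAct (fun x => (holAt U₀ (path x))⁻¹ * holAt U (path x)) U s.bond : SU2) : Matrix (Fin 2) (Fin 2) ℂ) *
      star ((U₀ s.bond : SU2) : Matrix (Fin 2) (Fin 2) ℂ)) = 0
    rw [gaugeAct_pathGauge_apply_of_last path U₀ U hp hfwd hbwd, coe_mul_star_coe_SU, logCoordC_one]
  · -- (σ3): smoothness of the gauge-fixed field in the bond matrices, composed with the curve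
    intro γ hγ
    have hfun : (fun (t : ℝ) (b : PBond P 0) => ((gaugeAct (fun x => (holAt U₀ (path x))⁻¹ * holAt (γ t) (path x)) (γ t) b : SU2) : Matrix (Fin 2) (Fin 2) ℂ)) =
        (fun (V : PBond P 0 → Matrix (Fin 2) (Fin 2) ℂ) (b : PBond P 0) =>
          star (holM (coeField U₀) (path b.src)) * holM V (path b.src) * V b *
            star (star (holM (coeField U₀) (path b.tgt)) * holM V (path b.tgt))) ∘
        (fun t : ℝ => coeField (γ t)) := by
      funext t b
      exact coe_gaugeAct_pathGauge path U₀ (γ t) b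
    rw [hfun]
    exact (((contDiff_pathGaugeAct path U₀).differentiable (by simp)).differentiableAt).comp (0 : ℝ) hγ
  · -- (σ4): roots
    intro U j hj b hb
    obtain ⟨hs, ht⟩ := hF2 j hj b hb
    constructor
    · show (holAt U₀ (path (embIter j b.src)))⁻¹ * holAt U (path (embIter j b.src)) = 1
      rw [hs, holAt_nil, holAt_nil, inv_one, one_mul]
    · show (holAt U₀ (path (embIter j b.tgt)))⁻¹ * holAt U (path (embIter j b.tgt)) = 1
      rw [ht, holAt_nil, holAt_nil, inv_one, one_mul]

end Forest

/-! ## §3  The compositions: `hπ` and w1's `hcritT` binder from the forest datum -/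

section Composition

/-- ★★ **THE GAUGE RETRACTION `hπ` OF A ROOTED FOREST** — `B15Prop1GaugeRetractionOfGaugeSection.gaugeRetraction_of_gaugeSection` ∘ §2: the letter `hπ` of
`B15Prop1CritTransferOfGaugeRetraction.hcritT_curve_of_gaugeRetraction` from a rooted forest with (F1)–(F3) alone (`k ≤ m + K`, `𝐁` of levels `≤ k`). [cite: Balaban1985RegularSpaces, (1.19) p.79; Balaban1985Variational, (4) p.278, (16)–(18) p.280; Balaban1985Averaging, (8),(11) pp.18–19, (21) p.21; Balaban1988Convergent, (0.2) p.244, (2.10)–(2.11) p.256] -/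
theorem gaugeRetraction_of_forest (𝔹 : DetSet P) (k : ℕ) (hk : k ≤ P.m + P.K) (h𝔹 : ∀ j, k < j → 𝔹 j = ∅)
    (Q₀ U₀ : GaugeField P 0 SU2) (S : Submodule ℂ (VecField P 0 (EuclideanSpace ℂ (Fin 3))))
    (path : Site P 0 → List (LStep P 0))
    (hF1 : ∀ x, ∀ s ∈ path x, ∃ x' x'' : Site P 0, path x'' = path x' ++ [s] ∧
      (s.fwd = true → s.bond.src = x' ∧ s.bond.tgt = x'') ∧ (s.fwd = false → s.bond.src = x'' ∧ s.bond.tgt = x'))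
    (hF2 : ∀ j, j ≤ k → ∀ c ∈ bondsOf (𝔹 j), path (embIter j c.src) = [] ∧ path (embIter j c.tgt) = [])
    (hF3 : ∀ X : VecField P 0 (EuclideanSpace ℂ (Fin 3)), X ∈ S ↔ ∀ x, ∀ s ∈ path x, X s.bond = 0) :
    ∀ᶠ w in 𝓝 ((0 : S), coeField Q₀), ∀ U' Q' : GaugeField P 0 SU2,
      expMulC (w.1 : VecField P 0 (EuclideanSpace ℂ (Fin 3))) (coeField U₀) = coeField U' → coeField Q' = w.2 →
        AgreeOn 𝔹 (avgFamily (fun j => blockAvg (P := P) (j := j) expMeanLogSU) U') (avgFamily (fun j => blockAvg (P := P) (j := j) expMeanLogSU) Q') →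
        ∀ γ : ℝ → GaugeField P 0 SU2, γ 0 = U' →
          DifferentiableAt ℝ (fun (t : ℝ) (b : PBond P 0) => ((γ t b : SU2) : Matrix (Fin 2) (Fin 2) ℂ)) 0 →
          (∀ᶠ t in 𝓝 (0 : ℝ), AgreeOn 𝔹 (avgFamily (fun j => blockAvg (P := P) (j := j) expMeanLogSU) (γ t))
            (avgFamily (fun j => blockAvg (P := P) (j := j) expMeanLogSU) Q')) →
          ∃ X : ℝ → S, X 0 = w.1 ∧ DifferentiableAt ℝ X 0 ∧
            ∀ᶠ t in 𝓝 (0 : ℝ), ∃ V : GaugeField P 0 SU2,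
              expMulC (X t : VecField P 0 (EuclideanSpace ℂ (Fin 3))) (coeField U₀) = coeField V ∧
              wilsonAction4 V = wilsonAction4 (γ t) ∧
              AgreeOn 𝔹 (avgFamily (fun j => blockAvg (P := P) (j := j) expMeanLogSU) V) (avgFamily (fun j => blockAvg (P := P) (j := j) expMeanLogSU) Q') := by
  obtain ⟨σ, h1, h2, h3, h4⟩ := exists_gaugeSection_of_forest 𝔹 k U₀ S path hF1 hF2 hF3
  exact gaugeRetraction_of_gaugeSection 𝔹 k hk h𝔹 Q₀ U₀ S σ h1 h2 h3 h4

/-- ★★ **w1's `hcritT` BINDER AT CURVE-CRITICALITY FROM THE FOREST DATUM**: base-field data (guards, `U₀` on the base fibre, the axial slice `S` of the forest, action and constraint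
coordinates characterised pointwise) + (F1)–(F3) ⟹ the `hcritT` binder of `B15Prop1LocalChartAtBaseField.exists_localChart_at_baseField` at `Crit :=` curve-criticality — after this the
criticality transfer displays only the CHOICE of the comb `path` ([6] (1.19) `Ax_k(𝔅_k, U₀)`). [cite: Balaban1985Variational, Thm 1 p.279, (4) p.278, (16)–(18) p.280, Sect. F p.300; Balaban1985RegularSpaces, (1.19) p.79; Balaban1988Convergent, (2.10)–(2.12) p.256] -/
theorem hcritT_curve_of_forest (𝔹 : DetSet P) (k : ℕ) (hk : k ≤ P.m + P.K) (h𝔹 : ∀ j, k < j → 𝔹 j = ∅) {Q₀ U₀ : GaugeField P 0 SU2}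
    (hsbQ : SmallBelow (fun j => blockAvg (P := P) (j := j) expMeanLogSU) k Q₀)
    (hsbU : SmallBelow (fun j => blockAvg (P := P) (j := j) expMeanLogSU) k U₀)
    (hU₀ : AgreeOn 𝔹 (avgFamily (fun j => blockAvg (P := P) (j := j) expMeanLogSU) U₀) (avgFamily (fun j => blockAvg (P := P) (j := j) expMeanLogSU) Q₀))
    (S : Submodule ℂ (VecField P 0 (EuclideanSpace ℂ (Fin 3))))
    (a : S → ℂ)
    (ha : ∀ X : S, a X = ∑ p : Plaq P 0, (1 - (expMulC (X : VecField P 0 (EuclideanSpace ℂ (Fin 3))) (coeField U₀) ⟨p.src, p.μ⟩ *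
      expMulC (X : VecField P 0 (EuclideanSpace ℂ (Fin 3))) (coeField U₀) ⟨p.src.shift p.μ, p.ν⟩ *
      Matrix.adjugate (expMulC (X : VecField P 0 (EuclideanSpace ℂ (Fin 3))) (coeField U₀) ⟨p.src.shift p.ν, p.μ⟩) *
      Matrix.adjugate (expMulC (X : VecField P 0 (EuclideanSpace ℂ (Fin 3))) (coeField U₀) ⟨p.src, p.ν⟩)).trace / 2))
    (Φ₀ : S → Fin (constrCard 𝔹 k) → EuclideanSpace ℂ (Fin 3))
    (hΦ₀ : ∀ (X : S) i, Φ₀ X i = logCoordC (star ((avgFamily (fun j => blockAvg (P := P) (j := j) expMeanLogSU) Q₀ ((constrEnum 𝔹 k).symm i).1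
      ((constrEnum 𝔹 k).symm i).2.1 : SU2) : Matrix (Fin 2) (Fin 2) ℂ) *
      iterMh ((constrEnum 𝔹 k).symm i).1 (expMulC (X : VecField P 0 (EuclideanSpace ℂ (Fin 3))) (coeField U₀)) ((constrEnum 𝔹 k).symm i).2.1))
    -- DISPLAYED: the rooted forest (the comb of [6] (1.19)) and its axial slice
    (path : Site P 0 → List (LStep P 0))
    (hF1 : ∀ x, ∀ s ∈ path x, ∃ x' x'' : Site P 0, path x'' = path x' ++ [s] ∧
      (s.fwd = true → s.bond.src = x' ∧ s.bond.tgt = x'') ∧ (s.fwd = false → s.bond.src = x'' ∧ s.bond.tgt = x'))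
    (hF2 : ∀ j, j ≤ k → ∀ c ∈ bondsOf (𝔹 j), path (embIter j c.src) = [] ∧ path (embIter j c.tgt) = [])
    (hF3 : ∀ X : VecField P 0 (EuclideanSpace ℂ (Fin 3)), X ∈ S ↔ ∀ x, ∀ s ∈ path x, X s.bond = 0) :
    ∀ᶠ w in 𝓝 ((0 : S), coeField Q₀), ∀ (U' Q' : GaugeField P 0 SU2) (μ : (Fin (constrCard 𝔹 k) → EuclideanSpace ℂ (Fin 3)) →L[ℂ] ℂ),
      expMulC (w.1 : VecField P 0 (EuclideanSpace ℂ (Fin 3))) (coeField U₀) = coeField U' → coeField Q' = w.2 →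
        AgreeOn 𝔹 (avgFamily (fun j => blockAvg (P := P) (j := j) expMeanLogSU) U') (avgFamily (fun j => blockAvg (P := P) (j := j) expMeanLogSU) Q') →
        fderiv ℂ a w.1 = μ.comp (fderiv ℂ Φ₀ w.1) →
          ∀ γ : ℝ → GaugeField P 0 SU2, γ 0 = U' →
            DifferentiableAt ℝ (fun (t : ℝ) (b : PBond P 0) => ((γ t b : SU2) : Matrix (Fin 2) (Fin 2) ℂ)) 0 →
            (∀ᶠ t in 𝓝 (0 : ℝ), AgreeOn 𝔹 (avgFamily (fun j => blockAvg (P := P) (j := j) expMeanLogSU) (γ t))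
              (avgFamily (fun j => blockAvg (P := P) (j := j) expMeanLogSU) Q')) →
            ∀ d : ℝ, HasDerivAt (fun t => wilsonAction4 (γ t)) d 0 → d = 0 :=
  hcritT_curve_of_gaugeRetraction 𝔹 k hsbQ hsbU hU₀ S a ha Φ₀ hΦ₀ (gaugeRetraction_of_forest 𝔹 k hk h𝔹 Q₀ U₀ S path hF1 hF2 hF3)

variable {F : T4Family}

/-- ★★ **THE RECORD TWIN**: on the torus `F.P Kt` of the family (`avOfRecord F 2 Kt`, `rfl`), n07-e's `Node00.IsCritOnFibre F 2 Kt 𝐁 (avgFamily (avOfRecord F 2 Kt) Q′) U′` for the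
slice-chart points near the base datum that are Lagrange-critical on the axial slice of a rooted forest with (F1)–(F3).  Applies verbatim to N12's `𝐁 := Bj ν.M₁ Z k`.
[cite: Balaban1985Variational, Thm 1 p.279, (16)–(18) p.280, Prop. 8 p.304; Balaban1985RegularSpaces, (1.19) p.79; Balaban1988Convergent, (2.10)–(2.13) pp.256–257; Balaban1989LargeFieldI, Prop. 1 p.194] -/
theorem hcritT_isCritOnFibre_of_forest (Kt : ℕ) (𝔹 : DetSet (F.P Kt)) (k : ℕ) (hk : k ≤ (F.P Kt).m + (F.P Kt).K) (h𝔹 : ∀ j, k < j → 𝔹 j = ∅)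
    {Q₀ U₀ : GaugeField (F.P Kt) 0 SU2}
    (hsbQ : SmallBelow (fun j => blockAvg (P := F.P Kt) (j := j) expMeanLogSU) k Q₀)
    (hsbU : SmallBelow (fun j => blockAvg (P := F.P Kt) (j := j) expMeanLogSU) k U₀)
    (hU₀ : AgreeOn 𝔹 (avgFamily (fun j => blockAvg (P := F.P Kt) (j := j) expMeanLogSU) U₀) (avgFamily (fun j => blockAvg (P := F.P Kt) (j := j) expMeanLogSU) Q₀))
    (S : Submodule ℂ (VecField (F.P Kt) 0 (EuclideanSpace ℂ (Fin 3))))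
    (a : S → ℂ)
    (ha : ∀ X : S, a X = ∑ p : Plaq (F.P Kt) 0, (1 - (expMulC (X : VecField (F.P Kt) 0 (EuclideanSpace ℂ (Fin 3))) (coeField U₀) ⟨p.src, p.μ⟩ *
      expMulC (X : VecField (F.P Kt) 0 (EuclideanSpace ℂ (Fin 3))) (coeField U₀) ⟨p.src.shift p.μ, p.ν⟩ *
      Matrix.adjugate (expMulC (X : VecField (F.P Kt) 0 (EuclideanSpace ℂ (Fin 3))) (coeField U₀) ⟨p.src.shift p.ν, p.μ⟩) *
      Matrix.adjugate (expMulC (X : VecField (F.P Kt) 0 (EuclideanSpace ℂ (Fin 3))) (coeField U₀) ⟨p.src, p.ν⟩)).trace / 2))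
    (Φ₀ : S → Fin (constrCard 𝔹 k) → EuclideanSpace ℂ (Fin 3))
    (hΦ₀ : ∀ (X : S) i, Φ₀ X i = logCoordC (star ((avgFamily (fun j => blockAvg (P := F.P Kt) (j := j) expMeanLogSU) Q₀ ((constrEnum 𝔹 k).symm i).1
      ((constrEnum 𝔹 k).symm i).2.1 : SU2) : Matrix (Fin 2) (Fin 2) ℂ) *
      iterMh ((constrEnum 𝔹 k).symm i).1 (expMulC (X : VecField (F.P Kt) 0 (EuclideanSpace ℂ (Fin 3))) (coeField U₀)) ((constrEnum 𝔹 k).symm i).2.1))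
    (path : Site (F.P Kt) 0 → List (LStep (F.P Kt) 0))
    (hF1 : ∀ x, ∀ s ∈ path x, ∃ x' x'' : Site (F.P Kt) 0, path x'' = path x' ++ [s] ∧
      (s.fwd = true → s.bond.src = x' ∧ s.bond.tgt = x'') ∧ (s.fwd = false → s.bond.src = x'' ∧ s.bond.tgt = x'))
    (hF2 : ∀ j, j ≤ k → ∀ c ∈ bondsOf (𝔹 j), path (embIter j c.src) = [] ∧ path (embIter j c.tgt) = [])
    (hF3 : ∀ X : VecField (F.P Kt) 0 (EuclideanSpace ℂ (Fin 3)), X ∈ S ↔ ∀ x, ∀ s ∈ path x, X s.bond = 0) :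
    ∀ᶠ w in 𝓝 ((0 : S), coeField Q₀), ∀ (U' Q' : GaugeField (F.P Kt) 0 SU2) (μ : (Fin (constrCard 𝔹 k) → EuclideanSpace ℂ (Fin 3)) →L[ℂ] ℂ),
      expMulC (w.1 : VecField (F.P Kt) 0 (EuclideanSpace ℂ (Fin 3))) (coeField U₀) = coeField U' → coeField Q' = w.2 →
        AgreeOn 𝔹 (avgFamily (fun j => blockAvg (P := F.P Kt) (j := j) expMeanLogSU) U') (avgFamily (fun j => blockAvg (P := F.P Kt) (j := j) expMeanLogSU) Q') →
        fderiv ℂ a w.1 = μ.comp (fderiv ℂ Φ₀ w.1) →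
          IsCritOnFibre F 2 Kt 𝔹 (avgFamily (avOfRecord F 2 Kt) Q') U' :=
  hcritT_isCritOnFibre_of_gaugeRetraction Kt 𝔹 k hsbQ hsbU hU₀ S a ha Φ₀ hΦ₀ (gaugeRetraction_of_forest 𝔹 k hk h𝔹 Q₀ U₀ S path hF1 hF2 hF3)

end Composition

end Literature.MathematicalPhysics.QuantumFieldTheory.Balaban1983to89.B15Prop1AxialGaugeSectionOfForest

end
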